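import Summits.Ventures.PercRepro.RankLevelSetCoreFiveTwentyNine
import Summits.Ventures.PercRepro.RankLevelSetPlaneTenPrime

/-!
# PercRepro — THE CORANK-`≥ 26` CORE THEOREM AT LEVEL `5` FROM RANK `27`, WITH `f(5) ≤ 19` (p7, gen 0; S2, R3″)

`proofs/SUBCLAIM-S2-p7.md` R3″. With mine-4's `ncard_le_nineteen_of_eRk_le_five_of_free` (RankLevelSetPlaneTenPrime:
every rank-`≤ 5` set of the `e`-free core has `≤ 19` points — the 10-point primality lemma) the flat-bound family of
`core_all_corank_of_bound_key` is `B = 19`: regime I needs `N₁ = 48 ≤ n = |E|` (`n ≥ p + 26`), regime II the key at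
`n = 2p`, decided for `27 ≤ p ≤ 36` and from the crude criterion `P₂ = 37` beyond. **`c025_core_five_nineteen`**:
the `e`-free core at level `5`, every corank `≥ 26`, every `p ≥ 27`. Axioms: standard.
-/

open scoped Matroid

namespace PercRepro

namespace ThmN

variable {α : Type}

/-- The regime-II key at `q = 5`, `B = 19`, `n = 2p`, for `27 ≤ p ≤ 36` — ten numerals, decided. -/
theorem key_two_mul_nineteen_of_le_36 (p : ℕ) (hp : 27 ≤ p) (hp' : p ≤ 36) :
    2 ^ (p + 5) * 2 ^ (19 - 5) * (2 * p).choose 5 ≤ (p + 5).choose p * (2 * p).choose (p - 1) := by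
  interval_cases p <;> decide

/-- **The `e`-free core at level `5`, every corank `≥ 26`, every rank `p ≥ 27`** (`f(5) ≤ 19`). -/
theorem c025_core_five_nineteen (M : Matroid α) [M.Finite] (p : ℕ) (hp : 27 ≤ p)
    (hR : M.eRank = (p : ℕ∞)) (hbig : p + 25 < M.E.ncard)
    (hfree : ∀ e ∈ M.E, ∃ A ⊆ M.E \ {e}, e ∉ M.closure A ∧ e ∉ M.closure ((M.E \ {e}) \ A)) : RLS M p 5 := by
  have hN₁ : ∀ n, 48 ≤ n → 8 * (5 + 1) * 2 ^ (19 - 5) * n ^ 5 ≤ 2 ^ n :=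
    mul_pow_le_two_pow_of_base (8 * (5 + 1) * 2 ^ (19 - 5)) 5 48 (by norm_num) (by norm_num) (by norm_num)
  have hBj : ∀ j : ℕ, j ≤ 5 → ∀ X ⊆ M.E, M.eRk X ≤ j → X.ncard + 5 ≤ 19 + j := by
    intro j hj X hX hr
    rcases Nat.lt_or_ge j 4 with h | h
    · have := ncard_add_one_le_two_pow_of_eRk_le M (not_isLoop_of_free M hfree) hfree j X hX hr
      interval_cases j <;> omega
    · rcases Nat.lt_or_ge j 5 with h5 | h5
      · have hj4 : j = 4 := by omega
        subst hj4
        have := ncard_le_ten_of_eRk_le_four_of_free M hfree hX hr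
        omega
      · have hj5 : j = 5 := by omega
        subst hj5
        have := ncard_le_nineteen_of_eRk_le_five_of_free M hfree hX hr
        omega
  have hkey : ∀ n, 2 * p ≤ n → 2 ^ (p + 5) * 2 ^ (19 - 5) * n.choose 5 ≤ (p + 5).choose p * n.choose (p - 1) := by
    rcases Nat.lt_or_ge p 37 with h | h
    · exact regimeII_key_of_base p 5 (2 ^ (19 - 5)) ((p + 5).choose p) (2 * p) (by omega) (by omega) (by omega)
        (key_two_mul_nineteen_of_le_36 p hp (by omega))
    · intro n hn
      have hP₂ := threshold_II_of_base 5 (2 ^ (19 - 5)) 37 (by norm_num) (by norm_num)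
      exact choose_mul_le_choose_mul_of_threshold n p 5 (2 ^ (19 - 5)) (by omega) hn (hP₂ p h)
  exact core_all_corank_of_bound_key 5 19 (by norm_num) (by norm_num) 48 hN₁ M p (by omega) (by omega) hkey hR
    (by omega) hfree hBj

end ThmN

end PercRepro
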